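import Literature.NumberTheory.Connes2026.EvenPartProjection
import Literature.Analysis.OperatorTheory.L2KernelPairing
import HarnessLib

/-!
# Kernels compressed to `L²(ℝ)_ev`: if `A` acts by the `L²` kernel `K`, then `A ∘ R` acts by `K(x, −y)` and
# `A ∘ P_ev` by `½ (K(x, y) + K(x, −y))`

LABEL (line 1): RH-FREE literature (theorems only; NO definition, NO named fact).  bears_on: LADDER-RH
W-C/W-P (C1 named-fact debt), cell `rh-crit`, sub-cell cc, overflow row O1 — infrastructure for the trace
VALUE step of the "annulus road" under `Connes1999_thm_VII_4_rat` (with `EvenPartProjection.tsum_inner_evenPart_eq`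
and `L2KernelPairing.hasSum_inner_op_op_integral`: `Σ_{ev basis} ⟨A f_i, B f_i⟩ = ∫∫ conj K_{A P_ev} · K_{B P_ev}`).
WHAT THIS IS NOT: any claim about positivity, Weil's criterion or RH.

Sources.  M. Reed, B. Simon (1972) [`ReedSimon1972`], Thm. VI.23 (kernel operators); A. Connes, C. Consani,
H. Moscovici (2024) [`ConnesConsaniMoscovici2024`], Def. 4.5 §4.6 (`L²(ℝ)_ev`).

## What is proved

For `K : ℝ → ℝ → ℂ` with `uncurry K ∈ L²(ℝ²)` and a bounded `A` on `L²(ℝ)` with `(Aφ)(x) = ∫ K(x,y) φ(y) dy` a.e.: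
* `memLp_kernel_reflect` — `(x, y) ↦ K(x, −y)` is in `L²(ℝ²)`;
* **`kernel_comp_reflectL2`** — `(A (R φ))(x) = ∫ K(x, −y) φ(y) dy` a.e.;
* `memLp_kernel_evenSymm`, **`kernel_comp_starProjection_evenPart`** — `(A (P_ev φ))(x) = ∫ ½(K(x,y) + K(x,−y)) φ(y) dy` a.e.

No instance, notation or attribute; no `def`.
-/

noncomputable section

open _root_.MeasureTheory Complex Set Filter Function
open scoped Real Topology ComplexConjugate ENNReal InnerProductSpace

namespace Literature.NumberTheory.Connes2026

open Literature.NumberTheory.LFunctions Literature.Analysis.OperatorTheory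
open Literature.NumberTheory.ConnesConsani
open Literature.NumberTheory.ConnesConsani2024
open Literature.NumberTheory.ConnesConsani2021 hiding cutoffProj cutoffProj_coeFn

variable {K : ℝ → ℝ → ℂ}

/-- `(x, y) ↦ K(x, −y)` is square integrable when `K` is (`y ↦ −y` preserves Lebesgue measure). [cite: ReedSimon1972, Thm. VI.23, PDF pp. 198–199] -/
theorem memLp_kernel_reflect (hK : MemLp (uncurry K) 2 ((volume : Measure ℝ).prod (volume : Measure ℝ))) :
    MemLp (uncurry fun x y => K x (-y)) 2 ((volume : Measure ℝ).prod (volume : Measure ℝ)) := by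
  have hmp : MeasurePreserving (Prod.map (id : ℝ → ℝ) (fun y : ℝ => -y))
      ((volume : Measure ℝ).prod (volume : Measure ℝ)) ((volume : Measure ℝ).prod (volume : Measure ℝ)) :=
    (MeasurePreserving.id (volume : Measure ℝ)).prod (Measure.measurePreserving_neg (volume : Measure ℝ))
  have heq : (uncurry fun x y => K x (-y)) = uncurry K ∘ Prod.map (id : ℝ → ℝ) (fun y : ℝ => -y) := by
    funext z; rfl
  rw [heq]
  exact hK.comp_measurePreserving hmp

/-- **`A ∘ R` acts by the kernel `K(x, −y)`.** [cite: ReedSimon1972, Thm. VI.23, PDF pp. 198–199] -/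
theorem kernel_comp_reflectL2 {A : Lp ℂ 2 (volume : Measure ℝ) →L[ℂ] Lp ℂ 2 (volume : Measure ℝ)}
    (hA : ∀ φ : Lp ℂ 2 (volume : Measure ℝ), (A φ : ℝ → ℂ) =ᵐ[volume] fun x => ∫ y, K x y * φ y)
    (φ : Lp ℂ 2 (volume : Measure ℝ)) :
    (A (reflectL2 φ) : ℝ → ℂ) =ᵐ[volume] fun x => ∫ y, K x (-y) * φ y := by
  filter_upwards [hA (reflectL2 φ)] with x hx
  rw [hx]
  have h1 : ∫ y, K x y * (reflectL2 φ : ℝ → ℂ) y = ∫ y, K x y * (φ : ℝ → ℂ) (-y) :=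
    integral_congr_ae (by filter_upwards [reflectL2_coeFn φ] with y hy; rw [hy])
  rw [h1, ← integral_neg_eq_self (fun y => K x (-y) * (φ : ℝ → ℂ) y) (volume : Measure ℝ)]
  simp only [neg_neg]

/-- The symmetrized kernel `½(K(x,y) + K(x,−y))` is square integrable. [cite: ReedSimon1972, Thm. VI.23, PDF pp. 198–199] -/
theorem memLp_kernel_evenSymm (hK : MemLp (uncurry K) 2 ((volume : Measure ℝ).prod (volume : Measure ℝ))) :
    MemLp (uncurry fun x y => (2 : ℂ)⁻¹ * (K x y + K x (-y))) 2 ((volume : Measure ℝ).prod (volume : Measure ℝ)) := by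
  have h := (hK.add (memLp_kernel_reflect hK)).const_mul (2 : ℂ)⁻¹
  have heq : (uncurry fun x y => (2 : ℂ)⁻¹ * (K x y + K x (-y))) =
      fun z => (2 : ℂ)⁻¹ * (uncurry K + uncurry fun x y => K x (-y)) z := by
    funext z; rfl
  rw [heq]
  exact h

/-- **`A ∘ P_ev` acts by the symmetrized kernel `½(K(x,y) + K(x,−y))`** (`P_ev = ½(1 + R)`). [cite: ReedSimon1972, Thm. VI.23, PDF pp. 198–199; ConnesConsaniMoscovici2024, Def. 4.5 §4.6 p. 14] -/
theorem kernel_comp_starProjection_evenPart [evenPart.HasOrthogonalProjection]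
    (hK : MemLp (uncurry K) 2 ((volume : Measure ℝ).prod (volume : Measure ℝ)))
    {A : Lp ℂ 2 (volume : Measure ℝ) →L[ℂ] Lp ℂ 2 (volume : Measure ℝ)}
    (hA : ∀ φ : Lp ℂ 2 (volume : Measure ℝ), (A φ : ℝ → ℂ) =ᵐ[volume] fun x => ∫ y, K x y * φ y)
    (φ : Lp ℂ 2 (volume : Measure ℝ)) :
    (A ((evenPart : Submodule ℂ (Lp ℂ 2 (volume : Measure ℝ))).starProjection φ) : ℝ → ℂ) =ᵐ[volume]
      fun x => ∫ y, ((2 : ℂ)⁻¹ * (K x y + K x (-y))) * φ y := by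
  rw [starProjection_evenPart_eq, map_smul, map_add]
  have h1 := hA φ
  have h2 := kernel_comp_reflectL2 hA φ
  have hs1 := L2Kernel.ae_memLp_section (μ := (volume : Measure ℝ)) (ν := (volume : Measure ℝ)) hK
  have hs2 := L2Kernel.ae_memLp_section (μ := (volume : Measure ℝ)) (ν := (volume : Measure ℝ)) (memLp_kernel_reflect hK)
  filter_upwards [Lp.coeFn_smul (2 : ℂ)⁻¹ (A φ + A (reflectL2 φ)), Lp.coeFn_add (A φ) (A (reflectL2 φ)), h1, h2, hs1, hs2]
    with x hsm hadd e1 e2 m1 m2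
  rw [hsm, Pi.smul_apply, hadd, Pi.add_apply, e1, e2, smul_eq_mul]
  have i1 : Integrable (fun y => K x y * (φ : ℝ → ℂ) y) := m1.integrable_mul (Lp.memLp φ)
  have i2 : Integrable (fun y => K x (-y) * (φ : ℝ → ℂ) y) := m2.integrable_mul (Lp.memLp φ)
  rw [← integral_add i1 i2, ← integral_const_mul]
  refine integral_congr_ae (Eventually.of_forall fun y => ?_)
  ring

end Literature.NumberTheory.Connes2026
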